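import Literature.AlgebraicGeometry.AbelianSchemes.IsogenyRoofTransportAlongIso   -- ★ p847813 §1 points along isos, §2 (r3) one-sided; re-exports ★ (G-λ) `PolarizationLawAtFieldPoint`
import HarnessLib

/-!
# A SERRE COVER `c : A_{e,y} → A_{e′,y}` read on `Ω`-points TRANSPORTS along isomorphisms of the two outer fibres exact on `λ`, `ι`, level

Topic `AlgebraicGeometry/AbelianSchemes`; namespace `Literature.AlgebraicGeometry.AbelianSchemes.AbelianSchemeOver`.  THEOREMS ONLY (no definition, no
named fact, no instance, no notation, no `sorry`).  Cell `hodgecm-mathlib` (D-0151), P6 «MOD programme», half A line L4, E-readings leaf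
`Lines/F0_P6a_EReadings.lean` (LA4-plan (g0) cand v2) socket **`stub_COVERTRANS : RecordCoverTransport`** («the E-side Serre cover `CoverE … e … e′ 𝔞 n y` gives
the cover `CoverΩ … e … e′ 𝔞 n y` of the spread tuple along `gen_iso`»; LEAD F0P6-plan (g3) «M-55b» (3); LA4-plan DEAL v2 → LA4-p01 (g0)): the CUT-INDEPENDENT
per-point core, sister of ★ `IsogenyRoofTransportAlongIso` (p847813, the `RoofΩ` core).  `--supports stmt-HodgeConjecture-24832`, count-neutral.  HONEST LABEL:
HC_CM is proved only modulo the 2 remaining named inputs (hLiu418 24832, h413 24833) until rung 0 closes; this file is general and discharges none of them.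

THE MATHEMATICS ([Shimura1998] §13.1 Thm. 1 ∕ §18.6: the `𝔞`-multiplication `A → A ⊗_𝒪 𝔞⁻¹`-type Serre cover between Galois-conjugate CM fibres;
[MumfordAV1970] §15 Thm. 1 `(ψ ≫ χ)^∨ = χ^∨ ≫ ψ^∨`; [MumfordFogartyKirwan1994] Ch. 7 §2 Def. 7.2–7.3 «triples up to isomorphism»; [Milne2005ShimuraVarieties]
§14 pp. 124–125: every datum attached to `(A, i, λ, ηK)` is carried by an isomorphism respecting `(λ, i, η)`).  Over one base `S` (the consumer: `S = Spec Ω`)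
let `e : A₁ ≅ A₂`, `e′ : A₁′ ≅ A₂′` be isomorphisms of group schemes EXACT on the polarisations in dual-homomorphism form (`e ≫ λ₂ ≫ e^∨ = λ₁`,
`e′ ≫ λ₂′ ≫ e′^∨ = λ₁′`), on the endomorphism families (`ι₁(a) ≫ e = e ≫ ι₂(a)`, `ι₁′(a) ≫ e′ = e′ ≫ ι₂′(a)`) and on chosen families of `Ω`-points
(`e(σ₁ᵃ) = σ₂ᵃ`, `e′(σ₁′ᵃ) = σ₂′ᵃ`).  Then a SERRE COVER for side 1 — a homomorphism `c : A₁ → A₁′` with (t1) a Serre presentation «`∀ a ∈ 𝔞, ∃ d,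
c ≫ d = ι₁(a) ∧ d ≫ c = ι₁′(a)`», (t2) the upper bound «`∀ b ∈ 𝔟, ∃ f, c ≫ ι₁′(b) = f ≫ ι₁′(ν)`», (t3) `c ≫ λ₁′ ≫ c^∨ = λ₁ ≫ [n]`, (t4) `ι₁(a) ≫ c = c ≫ ι₁′(a)`,
(t5) `c(σ₁ᵃ) = σ₁′ᵃ` — is also a Serre cover for side 2 with `c₂ := e⁻¹ ≫ c ≫ e′`, `d₂ := e′⁻¹ ≫ d ≫ e`, `f₂ := e⁻¹ ≫ f ≫ e′`: (t1)(t2)(t4) by conjugation,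
(t5) because `e`, `e′` carry the points, (t3) by ★ (G-λ) `comp_lam_comp_dualIsogenyOver_eq_mulN_iff_of_iso` («the law `U ≫ λ_B ≫ U^∨ = λ_A ≫ [c]` transports
along `λ`-exact isomorphisms», read with `e_A := e⁻¹`, `e_B := e′⁻¹`; the inverse isomorphisms are `λ`-exact by ★ `inv_comp_lam_comp_dualIsogenyOver_inv_of_eq`).
The clause texts are VERBATIM those of the P6a Defs reader `CoverΩ` (Defs ED. 3 :409–:436) ∕ the E-reading `CoverE` with the readers abstracted
(`schΩOf ↦ Aᵢ`, `fibreΩOf ↦ Aᵢ.toAffine.toAbelianVariety`, `actΩOf … .hom.hom.hom ↦ act`, `a ∈ 𝔞 ↦ 𝔞 a`, `b ∈ c • 𝔞 ↦ 𝔟 b`, `(n : 𝓞 F) ↦ ν`,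
`lvlPtΩOf ↦ pt`), so the consumer instantiates by unification (as for ★ `roof_transport_along_iso`).

* §1 `inv_comp_comp_hom_conj` ∕ `conj_comm_of_comm` — conjugation book-keeping (`(e⁻¹ ≫ x ≫ e′) ≫ (e′⁻¹ ≫ y ≫ e) = e⁻¹ ≫ (x ≫ y) ≫ e`, intertwining);
* §2 (t3) two-sided: `comp_lam_comp_dualIsogenyOver_eq_mulN_of_conj`;
* §3 **`cover_transport_along_iso`** — THE HEAD.

## References
* [Shimura1998] G. Shimura, *Abelian Varieties with Complex Multiplication and Modular Functions* (1998), §13.1 Theorem 1 (pp. 97–99), §18.6 (pp. 124–127).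
* [MumfordAV1970] D. Mumford, *Abelian Varieties* (1970), §15 Thm. 1 (p. 143); §23 Thm. 2 (p. 231).
* [MumfordFogartyKirwan1994] D. Mumford, J. Fogarty, F. Kirwan, *Geometric Invariant Theory*, 3rd ed. (1994), Ch. 7 §2 Def. 7.2 (p. 129), Def. 7.3 (p. 130).
* [Milne2005ShimuraVarieties] J. S. Milne, *Introduction to Shimura varieties* (2005), §14 pp. 124–125.
* [MilneAV2008] J. S. Milne, *Abelian Varieties* (2008), I §9 Thm. 9.1 (p. 42).
* [RapoportSmithlingZhang2020Diagonal] M. Rapoport, B. Smithling, W. Zhang (2020), §3.2 p. 11, §4.3 p. 20 (the twists between the sheets).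
-/

set_option autoImplicit false

noncomputable section

-- Mathlib's `Over`/pull-back API is stated across semireducible wrappers (as in the ★ `AbelianSchemes/*` files).
set_option backward.isDefEq.respectTransparency false

universe u

open CategoryTheory CategoryTheory.Limits AlgebraicGeometry MonoidalCategory
open scoped MonObj

namespace Literature.AlgebraicGeometry.AbelianSchemes

namespace AbelianSchemeOver

open Literature.AlgebraicGeometry.Motives (AlgPoints)

/-! ### §1 Conjugation book-keeping -/

section Conj

variable {C : Type*} [Category C] {X₁ X₂ X₁' X₂' : C} (e : X₁ ≅ X₂) (e' : X₁' ≅ X₂')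

/-- `(e⁻¹ ≫ x ≫ e′) ≫ (e′⁻¹ ≫ y ≫ e) = e⁻¹ ≫ (x ≫ y) ≫ e`. [cite: MumfordFogartyKirwan1994, Ch. 7 §2 Definition 7.3 (p. 130)] -/
theorem inv_comp_comp_hom_conj (x : X₁ ⟶ X₁') (y : X₁' ⟶ X₁) :
    (e.inv ≫ x ≫ e'.hom) ≫ (e'.inv ≫ y ≫ e.hom) = e.inv ≫ (x ≫ y) ≫ e.hom := by
  simp only [Category.assoc, Iso.hom_inv_id_assoc]

/-- An intertwining `a₁ ≫ e = e ≫ a₂` read as `e⁻¹ ≫ a₁ ≫ e = a₂`. [cite: MumfordFogartyKirwan1994, Ch. 7 §2 Definition 7.3 (p. 130)] -/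
theorem inv_comp_comp_hom_eq_of_comm {a₁ : X₁ ⟶ X₁} {a₂ : X₂ ⟶ X₂} (h : a₁ ≫ e.hom = e.hom ≫ a₂) : e.inv ≫ a₁ ≫ e.hom = a₂ := by
  rw [h, Iso.inv_hom_id_assoc]

/-- An intertwining `a₁ ≫ e = e ≫ a₂` read as `a₂ ≫ e⁻¹ = e⁻¹ ≫ a₁`. [cite: MumfordFogartyKirwan1994, Ch. 7 §2 Definition 7.3 (p. 130)] -/
theorem comp_inv_eq_inv_comp_of_comm {a₁ : X₁ ⟶ X₁} {a₂ : X₂ ⟶ X₂} (h : a₁ ≫ e.hom = e.hom ≫ a₂) : a₂ ≫ e.inv = e.inv ≫ a₁ := by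
  rw [Iso.comp_inv_eq, Category.assoc, h, Iso.inv_hom_id_assoc]

end Conj

/-! ### §2 (t3) two-sided: the law `c ≫ λ′ ≫ c^∨ = λ ≫ [n]` along `e⁻¹ ≫ c ≫ e′` -/

section Lambda

variable {S : Scheme.{u}} [IsReduced S] [IsLocallyNoetherian S] {A₁ A₂ A₁' A₂' : AbelianSchemeOver S}
  (D₁ : A₁.DualPair) (D₂ : A₂.DualPair) (D₁' : A₁'.DualPair) (D₂' : A₂'.DualPair)
  (hD₁ : Nonempty ((Scheme.Modules.pullback (DualPair.unitHatSlice D₁)).obj D₁.P ≅ SheafOfModules.unit _))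
  (hD₂ : Nonempty ((Scheme.Modules.pullback (DualPair.unitHatSlice D₂)).obj D₂.P ≅ SheafOfModules.unit _))
  (hD₁' : Nonempty ((Scheme.Modules.pullback (DualPair.unitHatSlice D₁')).obj D₁'.P ≅ SheafOfModules.unit _))
  (hD₂' : Nonempty ((Scheme.Modules.pullback (DualPair.unitHatSlice D₂')).obj D₂'.P ≅ SheafOfModules.unit _))
  (lam₁ : A₁.X ⟶ D₁.hat.X) (lam₂ : A₂.X ⟶ D₂.hat.X) (lam₁' : A₁'.X ⟶ D₁'.hat.X) (lam₂' : A₂'.X ⟶ D₂'.hat.X)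
  (e : A₁.X ≅ A₂.X) [IsMonHom e.hom] (e' : A₁'.X ≅ A₂'.X) [IsMonHom e'.hom] (c : A₁.X ⟶ A₁'.X) [IsMonHom c] (n : ℕ)

include hD₁ hD₂ hD₁' hD₂' in
/-- **(t3) TRANSPORTS**: if `e : A₁ ≅ A₂`, `e′ : A₁′ ≅ A₂′` are exact on `λ` in dual-homomorphism form and `c ≫ λ₁′ ≫ c^∨ = λ₁ ≫ [n]`, then
`(e⁻¹ ≫ c ≫ e′) ≫ λ₂′ ≫ (e⁻¹ ≫ c ≫ e′)^∨ = λ₂ ≫ [n]` — ★ (G-λ) `comp_lam_comp_dualIsogenyOver_eq_mulN_iff_of_iso` with `e_A := e⁻¹`, `e_B := e′⁻¹` (both `λ`-exact by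
★ `inv_comp_lam_comp_dualIsogenyOver_inv_of_eq`). [cite: MumfordAV1970, §15 Thm. 1 (p. 143)] [cite: MilneAV2008, I §9 Thm. 9.1 (p. 42)] -/
theorem comp_lam_comp_dualIsogenyOver_eq_mulN_of_conj
    (he : e.hom ≫ lam₂ ≫ DualPair.dualIsogenyOver e.hom D₁ D₂ = lam₁)
    (he' : e'.hom ≫ lam₂' ≫ DualPair.dualIsogenyOver e'.hom D₁' D₂' = lam₁')
    (h : c ≫ lam₁' ≫ DualPair.dualIsogenyOver c D₁ D₁' = lam₁ ≫ D₁.hat.mulN n) :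
    (e.inv ≫ c ≫ e'.hom) ≫ lam₂' ≫ DualPair.dualIsogenyOver (e.inv ≫ c ≫ e'.hom) D₂ D₂' = lam₂ ≫ D₂.hat.mulN n := by
  haveI : IsMonHom e.symm.hom := (inferInstance : IsMonHom e.inv)
  haveI : IsMonHom e'.symm.hom := (inferInstance : IsMonHom e'.inv)
  -- the inverse isomorphisms are `λ`-exact
  have heA : e.symm.hom ≫ lam₁ ≫ DualPair.dualIsogenyOver e.symm.hom D₂ D₁ = lam₂ :=
    inv_comp_lam_comp_dualIsogenyOver_inv_of_eq D₁ D₂ lam₁ lam₂ hD₂ e he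
  have heB : e'.symm.hom ≫ lam₁' ≫ DualPair.dualIsogenyOver e'.symm.hom D₂' D₁' = lam₂' :=
    inv_comp_lam_comp_dualIsogenyOver_inv_of_eq D₁' D₂' lam₁' lam₂' hD₂' e' he'
  have key := (comp_lam_comp_dualIsogenyOver_eq_mulN_iff_of_iso D₁ D₂ D₁' D₂' hD₁ hD₂ hD₁' lam₁ lam₂ lam₁' lam₂' e.symm e'.symm c n
    heA heB).mp h
  simpa only [Iso.symm_hom, Iso.symm_inv] using key

end Lambda

/-! ### §3 The head: a Serre cover transports along isomorphisms of the outer fibres -/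

section Cover

variable {Ω : Type u} [Field Ω] {A₁ A₂ A₁' A₂' : AbelianSchemeOver (Spec (.of Ω))}
  (D₁ : A₁.DualPair) (D₂ : A₂.DualPair) (D₁' : A₁'.DualPair) (D₂' : A₂'.DualPair)
  (hD₁ : Nonempty ((Scheme.Modules.pullback (DualPair.unitHatSlice D₁)).obj D₁.P ≅ SheafOfModules.unit _))
  (hD₂ : Nonempty ((Scheme.Modules.pullback (DualPair.unitHatSlice D₂)).obj D₂.P ≅ SheafOfModules.unit _))
  (hD₁' : Nonempty ((Scheme.Modules.pullback (DualPair.unitHatSlice D₁')).obj D₁'.P ≅ SheafOfModules.unit _))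
  (hD₂' : Nonempty ((Scheme.Modules.pullback (DualPair.unitHatSlice D₂')).obj D₂'.P ≅ SheafOfModules.unit _))
  (lam₁ : A₁.X ⟶ D₁.hat.X) (lam₂ : A₂.X ⟶ D₂.hat.X) (lam₁' : A₁'.X ⟶ D₁'.hat.X) (lam₂' : A₂'.X ⟶ D₂'.hat.X)
  {O : Type*} (act₁ : O → (A₁.X ⟶ A₁.X)) (act₂ : O → (A₂.X ⟶ A₂.X))
  (act₁' : O → (A₁'.X ⟶ A₁'.X)) (act₂' : O → (A₂'.X ⟶ A₂'.X))
  {J : Type*} (pt₁ : J → A₁.toAffine.toAbelianVariety.Points Ω) (pt₂ : J → A₂.toAffine.toAbelianVariety.Points Ω)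
  (pt₁' : J → A₁'.toAffine.toAbelianVariety.Points Ω) (pt₂' : J → A₂'.toAffine.toAbelianVariety.Points Ω)
  (𝔞 𝔟 : O → Prop) (ν : O)
  (e : A₁.X ≅ A₂.X) [IsMonHom e.hom] (e' : A₁'.X ≅ A₂'.X) [IsMonHom e'.hom] (n : ℕ)

include hD₁ hD₂ hD₁' hD₂' in
/-- **THE SERRE COVER TRANSPORTS ALONG ISOMORPHISMS OF THE OUTER FIBRES.**  Let `e : A₁ ≅ A₂`, `e′ : A₁′ ≅ A₂′` be isomorphisms of group schemes over
`Spec Ω`, exact on the polarisations in dual-homomorphism form (`he`, `he′`), on the endomorphism families (`hact`, `hact′`) and on the chosen point families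
(`hpt`, `hpt′`).  Then a Serre cover `c : A₁ → A₁′` with the clauses (t1)–(t5) of the P6a reader `CoverΩ` ∕ `CoverE` for side 1 (Serre presentation of `𝔞`,
upper bound through `𝔟` and `ν`, `c ≫ λ₁′ ≫ c^∨ = λ₁ ≫ [n]`, `ι`-equivariance, level points) yields the Serre cover `e⁻¹ ≫ c ≫ e′ : A₂ → A₂′` with the same
clauses for side 2 (same `𝔞 𝔟 ν n`).  (t1)(t2)(t4): §1 conjugation; (t3): §2; (t5): `e`, `e′` carry the points (★ `map_inv_map_hom`).
[cite: Shimura1998, §13.1 Theorem 1 (pp. 97–99); §18.6 (pp. 124–127)] [cite: MumfordAV1970, §15 Thm. 1 (p. 143)]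
[cite: MumfordFogartyKirwan1994, Ch. 7 §2 Definition 7.2 (p. 129) and Definition 7.3 (p. 130)] [cite: Milne2005ShimuraVarieties, §14 pp. 124–125] -/
theorem cover_transport_along_iso
    (he : e.hom ≫ lam₂ ≫ DualPair.dualIsogenyOver e.hom D₁ D₂ = lam₁)
    (he' : e'.hom ≫ lam₂' ≫ DualPair.dualIsogenyOver e'.hom D₁' D₂' = lam₁')
    (hact : ∀ a, act₁ a ≫ e.hom = e.hom ≫ act₂ a) (hact' : ∀ a, act₁' a ≫ e'.hom = e'.hom ≫ act₂' a)
    (hpt : ∀ i, (AlgPoints.map e.hom (pt₁ i) : A₂.toAffine.toAbelianVariety.Points Ω) = pt₂ i)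
    (hpt' : ∀ i, (AlgPoints.map e'.hom (pt₁' i) : A₂'.toAffine.toAbelianVariety.Points Ω) = pt₂' i)
    (hcover : ∃ (c : A₁.X ⟶ A₁'.X) (_ : IsMonHom c),
        (∀ a, 𝔞 a → ∃ d : A₁'.X ⟶ A₁.X, c ≫ d = act₁ a ∧ d ≫ c = act₁' a) ∧
        (∀ b, 𝔟 b → ∃ f : A₁.X ⟶ A₁'.X, c ≫ act₁' b = f ≫ act₁' ν) ∧
        c ≫ lam₁' ≫ DualPair.dualIsogenyOver c D₁ D₁' = lam₁ ≫ D₁.hat.mulN n ∧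
        (∀ a, act₁ a ≫ c = c ≫ act₁' a) ∧
        (∀ i : J, (AlgPoints.map c (pt₁ i) : A₁'.toAffine.toAbelianVariety.Points Ω) = pt₁' i)) :
    ∃ (c : A₂.X ⟶ A₂'.X) (_ : IsMonHom c),
        (∀ a, 𝔞 a → ∃ d : A₂'.X ⟶ A₂.X, c ≫ d = act₂ a ∧ d ≫ c = act₂' a) ∧
        (∀ b, 𝔟 b → ∃ f : A₂.X ⟶ A₂'.X, c ≫ act₂' b = f ≫ act₂' ν) ∧
        c ≫ lam₂' ≫ DualPair.dualIsogenyOver c D₂ D₂' = lam₂ ≫ D₂.hat.mulN n ∧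
        (∀ a, act₂ a ≫ c = c ≫ act₂' a) ∧
        (∀ i : J, (AlgPoints.map c (pt₂ i) : A₂'.toAffine.toAbelianVariety.Points Ω) = pt₂' i) := by
  obtain ⟨c, hc, t1, t2, t3, t4, t5⟩ := hcover
  haveI : IsMonHom e.inv := inferInstance
  haveI : IsMonHom e'.inv := inferInstance
  refine ⟨e.inv ≫ c ≫ e'.hom, inferInstance, fun a ha => ?_, fun b hb => ?_,
    comp_lam_comp_dualIsogenyOver_eq_mulN_of_conj D₁ D₂ D₁' D₂' hD₁ hD₂ hD₁' hD₂' lam₁ lam₂ lam₁' lam₂' e e' c n he he' t3,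
    fun a => ?_, fun i => ?_⟩
  · -- (t1) Serre presentation: `d₂ := e′⁻¹ ≫ d ≫ e`
    obtain ⟨d, hcd, hdc⟩ := t1 a ha
    refine ⟨e'.inv ≫ d ≫ e.hom, ?_, ?_⟩
    · rw [inv_comp_comp_hom_conj e e' c d, hcd, inv_comp_comp_hom_eq_of_comm e (hact a)]
    · rw [inv_comp_comp_hom_conj e' e d c, hdc, inv_comp_comp_hom_eq_of_comm e' (hact' a)]
  · -- (t2) upper bound: `f₂ := e⁻¹ ≫ f ≫ e′`
    obtain ⟨f, hf⟩ := t2 b hb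
    refine ⟨e.inv ≫ f ≫ e'.hom, ?_⟩
    have h1 : act₂' b = e'.inv ≫ act₁' b ≫ e'.hom := (inv_comp_comp_hom_eq_of_comm e' (hact' b)).symm
    have h2 : act₂' ν = e'.inv ≫ act₁' ν ≫ e'.hom := (inv_comp_comp_hom_eq_of_comm e' (hact' ν)).symm
    rw [h1, h2]
    simp only [Category.assoc, Iso.hom_inv_id_assoc]
    rw [reassoc_of% hf]
  · -- (t4) equivariance by conjugation
    have h1 : act₂ a ≫ e.inv = e.inv ≫ act₁ a := comp_inv_eq_inv_comp_of_comm e (hact a)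
    rw [← Category.assoc, h1, Category.assoc, Category.assoc, Category.assoc, reassoc_of% (t4 a), ← hact' a]
  · -- (t5) the chosen points correspond
    rw [AlgPoints.map_comp_apply, AlgPoints.map_comp_apply, ← hpt i, ← hpt' i, map_inv_map_hom, t5 i]

end Cover

/-! ### §4 (ED. 2) The KERNEL CLAUSE (t1′) «`Ker c = A[𝔞]` on all `T`-points» transports too — the core of `stub_COVERKERTRANS` -/

section Kernel

variable {C : Type*} [Category C] [CartesianMonoidalCategory C] {M N X : C} [MonObj M] [MonObj N] (e : M ≅ N) [IsMonHom e.hom]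

/-- `f ≫ e = 1 ↔ f = 1` for an isomorphism of monoid objects `e` (`1 ≫ e⁻¹ = 1`, Mathlib `MonObj.one_comp` for the homomorphism `e⁻¹`); general-category twin of ★
`FrobeniusTwistOfRoof.comp_iso_inv_eq_one_iff` (there over `Over S` with `GrpObj`; not imported: Serre-tensor weight). [cite: MumfordAV1970, §7 Thm. 4 (p. 72)] -/
theorem comp_grpIso_hom_eq_one_iff (f : X ⟶ M) : f ≫ e.hom = 1 ↔ f = 1 := by
  haveI : IsMonHom e.inv := inferInstance
  refine ⟨fun h => ?_, fun h => by rw [h, MonObj.one_comp]⟩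
  rw [← Category.comp_id f, ← e.hom_inv_id, ← Category.assoc, h, MonObj.one_comp]

/-- `f ≫ e⁻¹ = 1 ↔ f = 1`. [cite: MumfordAV1970, §7 Thm. 4 (p. 72)] -/
theorem comp_grpIso_inv_eq_one_iff (f : X ⟶ N) : f ≫ e.inv = 1 ↔ f = 1 := by
  haveI : IsMonHom e.symm.hom := (inferInstance : IsMonHom e.inv)
  exact comp_grpIso_hom_eq_one_iff e.symm f

end Kernel

section KernelClause

variable {C : Type*} [Category C] [CartesianMonoidalCategory C] {A₁ A₂ A₁' A₂' : C} [MonObj A₁] [MonObj A₂] [MonObj A₁'] [MonObj A₂']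
  (e : A₁ ≅ A₂) [IsMonHom e.hom] (e' : A₁' ≅ A₂') [IsMonHom e'.hom]
  {O : Type*} (act₁ : O → (A₁ ⟶ A₁)) (act₂ : O → (A₂ ⟶ A₂)) (𝔞 : O → Prop) (c : A₁ ⟶ A₁')

/-- **THE KERNEL CLAUSE TRANSPORTS** (Q-COV-KER (t1′) of the spine ED. 4 `CoverKerΩ`): if `Ker c = A₁[𝔞]` on all `T`-points (`t ≫ c = 1 ↔ ∀ a ∈ 𝔞, t ≫ ι₁(a) = 1`)
and `ι₁(a) ≫ e = e ≫ ι₂(a)`, then `Ker (e⁻¹ ≫ c ≫ e′) = A₂[𝔞]` on all `T`-points: read the clause at `t ≫ e⁻¹` and cancel the isomorphisms `e′`, `e⁻¹` against `1`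
(`comp_grpIso_hom∕inv_eq_one_iff`). [cite: MumfordAV1970, §7 Thm. 4 (p. 72), §23 Thm. 2 (p. 231)] [cite: Shimura1998, §13.1 Theorem 1 (pp. 97–99)] -/
theorem kernel_clause_transport_along_iso (hact : ∀ a, act₁ a ≫ e.hom = e.hom ≫ act₂ a)
    (h : ∀ ⦃T : C⦄ (t : T ⟶ A₁), t ≫ c = 1 ↔ ∀ a, 𝔞 a → t ≫ act₁ a = 1) ⦃T : C⦄ (t : T ⟶ A₂) :
    t ≫ (e.inv ≫ c ≫ e'.hom) = 1 ↔ ∀ a, 𝔞 a → t ≫ act₂ a = 1 := by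
  have hinv : ∀ a, act₂ a ≫ e.inv = e.inv ≫ act₁ a := fun a => comp_inv_eq_inv_comp_of_comm e (hact a)
  rw [← Category.assoc, ← Category.assoc, comp_grpIso_hom_eq_one_iff e', h (t ≫ e.inv)]
  refine forall₂_congr fun a _ => ?_
  rw [Category.assoc, ← hinv a, ← Category.assoc, comp_grpIso_inv_eq_one_iff e]

end KernelClause

section CoverKer

variable {Ω : Type u} [Field Ω] {A₁ A₂ A₁' A₂' : AbelianSchemeOver (Spec (.of Ω))}
  (D₁ : A₁.DualPair) (D₂ : A₂.DualPair) (D₁' : A₁'.DualPair) (D₂' : A₂'.DualPair)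
  (hD₁ : Nonempty ((Scheme.Modules.pullback (DualPair.unitHatSlice D₁)).obj D₁.P ≅ SheafOfModules.unit _))
  (hD₂ : Nonempty ((Scheme.Modules.pullback (DualPair.unitHatSlice D₂)).obj D₂.P ≅ SheafOfModules.unit _))
  (hD₁' : Nonempty ((Scheme.Modules.pullback (DualPair.unitHatSlice D₁')).obj D₁'.P ≅ SheafOfModules.unit _))
  (hD₂' : Nonempty ((Scheme.Modules.pullback (DualPair.unitHatSlice D₂')).obj D₂'.P ≅ SheafOfModules.unit _))
  (lam₁ : A₁.X ⟶ D₁.hat.X) (lam₂ : A₂.X ⟶ D₂.hat.X) (lam₁' : A₁'.X ⟶ D₁'.hat.X) (lam₂' : A₂'.X ⟶ D₂'.hat.X)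
  {O : Type*} (act₁ : O → (A₁.X ⟶ A₁.X)) (act₂ : O → (A₂.X ⟶ A₂.X))
  (act₁' : O → (A₁'.X ⟶ A₁'.X)) (act₂' : O → (A₂'.X ⟶ A₂'.X))
  {J : Type*} (pt₁ : J → A₁.toAffine.toAbelianVariety.Points Ω) (pt₂ : J → A₂.toAffine.toAbelianVariety.Points Ω)
  (pt₁' : J → A₁'.toAffine.toAbelianVariety.Points Ω) (pt₂' : J → A₂'.toAffine.toAbelianVariety.Points Ω)
  (𝔞 𝔟 : O → Prop) (ν : O)
  (e : A₁.X ≅ A₂.X) [IsMonHom e.hom] (e' : A₁'.X ≅ A₂'.X) [IsMonHom e'.hom] (n : ℕ)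

include hD₁ hD₂ hD₁' hD₂' in
/-- **THE SERRE COVER WITH ITS KERNEL CLAUSE TRANSPORTS ALONG ISOMORPHISMS OF THE OUTER FIBRES** — §3 `cover_transport_along_iso` with the clause (t1′)
«`t ≫ c = 1 ↔ ∀ a ∈ 𝔞, t ≫ ι(a) = 1` for all `T`-points `t`» carried INSIDE the same `∃ c` between (t1) and (t2) (the clause order of the spine ED. 4 `CoverKerΩ` ∕ the
E-reading `CoverKerE`): the cover for side 2 is again `e⁻¹ ≫ c ≫ e′`, its kernel clause by `kernel_clause_transport_along_iso`.
[cite: Shimura1998, §13.1 Theorem 1 (pp. 97–99); §18.6 (pp. 124–127)] [cite: MumfordAV1970, §7 Thm. 4 (p. 72); §15 Thm. 1 (p. 143)]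
[cite: MumfordFogartyKirwan1994, Ch. 7 §2 Definition 7.2 (p. 129) and Definition 7.3 (p. 130)] -/
theorem coverKer_transport_along_iso
    (he : e.hom ≫ lam₂ ≫ DualPair.dualIsogenyOver e.hom D₁ D₂ = lam₁)
    (he' : e'.hom ≫ lam₂' ≫ DualPair.dualIsogenyOver e'.hom D₁' D₂' = lam₁')
    (hact : ∀ a, act₁ a ≫ e.hom = e.hom ≫ act₂ a) (hact' : ∀ a, act₁' a ≫ e'.hom = e'.hom ≫ act₂' a)
    (hpt : ∀ i, (AlgPoints.map e.hom (pt₁ i) : A₂.toAffine.toAbelianVariety.Points Ω) = pt₂ i)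
    (hpt' : ∀ i, (AlgPoints.map e'.hom (pt₁' i) : A₂'.toAffine.toAbelianVariety.Points Ω) = pt₂' i)
    (hcover : ∃ (c : A₁.X ⟶ A₁'.X) (_ : IsMonHom c),
        (∀ a, 𝔞 a → ∃ d : A₁'.X ⟶ A₁.X, c ≫ d = act₁ a ∧ d ≫ c = act₁' a) ∧
        (∀ ⦃T : Literature.AlgebraicGeometry.Motives.SchemeOver Ω⦄ (t : T ⟶ A₁.X), t ≫ c = 1 ↔ ∀ a, 𝔞 a → t ≫ act₁ a = 1) ∧
        (∀ b, 𝔟 b → ∃ f : A₁.X ⟶ A₁'.X, c ≫ act₁' b = f ≫ act₁' ν) ∧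
        c ≫ lam₁' ≫ DualPair.dualIsogenyOver c D₁ D₁' = lam₁ ≫ D₁.hat.mulN n ∧
        (∀ a, act₁ a ≫ c = c ≫ act₁' a) ∧
        (∀ i : J, (AlgPoints.map c (pt₁ i) : A₁'.toAffine.toAbelianVariety.Points Ω) = pt₁' i)) :
    ∃ (c : A₂.X ⟶ A₂'.X) (_ : IsMonHom c),
        (∀ a, 𝔞 a → ∃ d : A₂'.X ⟶ A₂.X, c ≫ d = act₂ a ∧ d ≫ c = act₂' a) ∧
        (∀ ⦃T : Literature.AlgebraicGeometry.Motives.SchemeOver Ω⦄ (t : T ⟶ A₂.X), t ≫ c = 1 ↔ ∀ a, 𝔞 a → t ≫ act₂ a = 1) ∧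
        (∀ b, 𝔟 b → ∃ f : A₂.X ⟶ A₂'.X, c ≫ act₂' b = f ≫ act₂' ν) ∧
        c ≫ lam₂' ≫ DualPair.dualIsogenyOver c D₂ D₂' = lam₂ ≫ D₂.hat.mulN n ∧
        (∀ a, act₂ a ≫ c = c ≫ act₂' a) ∧
        (∀ i : J, (AlgPoints.map c (pt₂ i) : A₂'.toAffine.toAbelianVariety.Points Ω) = pt₂' i) := by
  obtain ⟨c, hc, t1, t1', t2, t3, t4, t5⟩ := hcover
  -- as in §3 the cover for side 2 is `e⁻¹ ≫ c ≫ e′` (built by name so that the kernel clause is attached to the SAME morphism)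
  haveI : IsMonHom e.inv := inferInstance
  haveI : IsMonHom e'.inv := inferInstance
  refine ⟨e.inv ≫ c ≫ e'.hom, inferInstance, fun a ha => ?_, kernel_clause_transport_along_iso e e' act₁ act₂ 𝔞 c hact t1', fun b hb => ?_,
    comp_lam_comp_dualIsogenyOver_eq_mulN_of_conj D₁ D₂ D₁' D₂' hD₁ hD₂ hD₁' hD₂' lam₁ lam₂ lam₁' lam₂' e e' c n he he' t3,
    fun a => ?_, fun i => ?_⟩
  · obtain ⟨d, hcd, hdc⟩ := t1 a ha
    refine ⟨e'.inv ≫ d ≫ e.hom, ?_, ?_⟩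
    · rw [inv_comp_comp_hom_conj e e' c d, hcd, inv_comp_comp_hom_eq_of_comm e (hact a)]
    · rw [inv_comp_comp_hom_conj e' e d c, hdc, inv_comp_comp_hom_eq_of_comm e' (hact' a)]
  · obtain ⟨f, hf⟩ := t2 b hb
    refine ⟨e.inv ≫ f ≫ e'.hom, ?_⟩
    have h1 : act₂' b = e'.inv ≫ act₁' b ≫ e'.hom := (inv_comp_comp_hom_eq_of_comm e' (hact' b)).symm
    have h2 : act₂' ν = e'.inv ≫ act₁' ν ≫ e'.hom := (inv_comp_comp_hom_eq_of_comm e' (hact' ν)).symm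
    rw [h1, h2]
    simp only [Category.assoc, Iso.hom_inv_id_assoc]
    rw [reassoc_of% hf]
  · have h1 : act₂ a ≫ e.inv = e.inv ≫ act₁ a := comp_inv_eq_inv_comp_of_comm e (hact a)
    rw [← Category.assoc, h1, Category.assoc, Category.assoc, Category.assoc, reassoc_of% (t4 a), ← hact' a]
  · rw [AlgPoints.map_comp_apply, AlgPoints.map_comp_apply, ← hpt i, ← hpt' i, map_inv_map_hom, t5 i]

end CoverKer

end AbelianSchemeOver

end Literature.AlgebraicGeometry.AbelianSchemes

end
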